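import Literature.NumberTheory.EllipticCurves.KrizLi2019.SexticTwistBSDThreeDescent
import Literature.NumberTheory.EllipticCurves.QuadraticTwistRank
import Literature.NumberTheory.EllipticCurves.VariableChangePointsMap
import Literature.NumberTheory.EllipticCurves.BSDInvariantsRegulatorProofs
import HarnessLib

/-!
# Height–index bookkeeping in the MINUS part: `m·#E(K)_tors²·ĥ_K(P) = 2·[E(K):ℤP]²·Reg(E^{(c)}/F)`
# when `rank E(K) = 1` and `E(F)` is finite (cell `bsd-eis`, seat `bsd-eis-k5-c5`; route
# `EisensteinPrimes` crux 5, the rank-ZERO mirror of the Gross–Zagier bookkeeping)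

HONEST FRAMING (cell `bsd-eis`, home `run/shared/lean/pub/bsd-eis/`; FULL-BSD rank-≤1 programme,
row A3 = X1 ∩ {r_an = 0}). THEOREMS ONLY; pure Mordell–Weil bookkeeping over already-landed
definitions; nothing about any particular curve, nothing booked, no label moves.

The tree's `KrizLi2019.exists_mul_canonicalHeight_eq_index_sq_mul_regulator` is the PLUS-part
bookkeeping of Gross–Zagier 1986 V.§2 / Jetchev–Skinner–Wan 2017 §7.4.1 used in display (5.6) of
Castella–Grossi–Lee–Skinner 2022 when `E` has rank one and its twist rank zero: for `K/F`
quadratic, `rank E(K) = rank E(F) = 1` and `P ∈ E(K)` of infinite order,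
`m·#E(K)_tors²·ĥ_K(P) = 2·[E(K):ℤP]²·Reg(E/F)`, `m ∈ {1,4}`. This file proves the MINUS-part twin
needed when the ranks of `E` and `E^K` are EXCHANGED (`E` of rank `0`, the Heegner point living in
the `(-1)`-eigenspace of `Gal(K/F)`): for `K = F(θ)`, `θ² = c`, `E(F)` finite, `rank E(K) = 1`,
`rank E^{(c)}(F) = 1` and `P ∈ E(K)` of infinite order,
`m·#E(K)_tors²·ĥ_K(P) = 2·[E(K):ℤP]²·Reg(E^{(c)}/F)` with `m ∈ {1,4}`
(`exists_mul_canonicalHeight_eq_index_sq_mul_regulator_twist`). Proof: with `g_K` a generator of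
`E(K)/tors`, the conjugation `σ` acts on `E(K)/tors ≅ ℤ` by `-1` (if by `+1`, `g_K + σ g_K ≡ 2g_K`
would be an `F`-rational point of infinite order); so `D = g_K − σ g_K ≡ 2 g_K` is `σ`-ANTI-fixed,
hence — transported to the completed-square model `E' = E^{(1)}` by an `F`-rational change of
variables (`VariableChange.pointEquivBaseChange`, Galois-equivariant, height-preserving) — the image
`τ(R)` of a point `R ∈ E^{(c)}(F)` under the twisting map `τ` of
`Literature/…/QuadraticTwistRank.lean` (`(x, y) ↦ (x/θ², y/θ³)`); writing `R ≡ j·g`, `τ(g) ≡ k·g_K`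
gives `jk = 2`, `m = k² ∈ {1,4}`, and `ĥ_K(τ g) = 2·ĥ_F(g) = 2·Reg(E^{(c)}/F)`
(`canonicalHeight_baseChange`, `canonicalHeight_pointEquiv`).

References: [GrossZagier1986] V.§2 (p. 311); [JetchevSkinnerWan2017] §7.4.1; [SilvermanAEC2009]
Exercise 10.16, VIII.9.1, VIII.9.3; [CastellaGrossiLeeSkinner2022] proof of Thm. 5.3.1, (5.6).
-/

noncomputable section

open scoped Classical

open WeierstrassCurve NumberField Literature.NumberTheory.EllipticCurves
  Literature.NumberTheory.EllipticCurves.KrizLi2019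
  Literature.NumberTheory.QuadraticFields

set_option autoImplicit false

namespace Summit.BirchSwinnertonDyer.Rank1Residual.X1.RankZeroHeightIndex

/-! ## §1. Transport lemmas along an equality of Weierstrass equations -/

section Congr

variable {L : Type} [Field L] [NumberField L]

/-- The canonical height is unchanged by the transport `congrEquiv` along an equality of
Weierstrass equations (the identity on coordinates). [folklore] -/
theorem canonicalHeight_congrEquiv {V₁ V₂ : WeierstrassCurve L} (h : V₁ = V₂)
    (P : V₁.toAffine.Point) :
    (Affine.Point.congrEquiv h P).canonicalHeight = P.canonicalHeight := by
  subst h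
  rfl

variable {F : Type} [Field F] [Algebra F L]

omit [NumberField L] in
/-- `congrEquiv` along `V₁ ⊗ L = V₂ ⊗ L` (for `V₁ = V₂` over `F`) commutes with the Galois action
on coordinates. [folklore] -/
theorem congrEquiv_map {V₁ V₂ : WeierstrassCurve F} (h : V₁ = V₂) (σ : L →ₐ[F] L)
    (P : (V₁.baseChange L).toAffine.Point) :
    Affine.Point.congrEquiv (congrArg (fun V : WeierstrassCurve F ↦ V.baseChange L) h)
        (Affine.Point.map (W' := V₁) σ P) =
      Affine.Point.map (W' := V₂) σ
        (Affine.Point.congrEquiv (congrArg (fun V : WeierstrassCurve F ↦ V.baseChange L) h) P) := by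
  subst h
  rfl

end Congr

/-! ## §2. The minus-part height–index relation -/

section Minus

variable {F : Type} [Field F] [NumberField F] (W : WeierstrassCurve F) [W.IsElliptic]
  (K : Type) [Field K] [NumberField K] [Algebra F K]

/-- **Height–index relation for a point of infinite order in the MINUS part.** Let `K = F(θ)`,
`θ² = c ∈ F`, `θ ∉ F`, be a quadratic extension of number fields and `E/F` elliptic with `E(F)`
FINITE, `rank E(K) = 1` and `rank E^{(c)}(F) = 1` (`E^{(c)} = W.quadraticTwist c`); let
`P ∈ E(K)` have infinite order. Then `m · #E(K)_tors² · ĥ_K(P) = 2 · [E(K) : ℤP]² · Reg(E^{(c)}/F)`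
for some `m ∈ {1, 4}` (`ĥ_K` the canonical height over `K`, `Reg(E^{(c)}/F) = ĥ_F(g)` for a generator
`g` of `E^{(c)}(F)/tors`). This is the bookkeeping "`ĥ(P_K) = [E(K):ℤP_K]²·Reg/…`" of Gross–Zagier
1986 V.§2 / Jetchev–Skinner–Wan 2017 §7.4.1 in the case where the Heegner point lies in the
`(-1)`-eigenspace of `Gal(K/F)` (rank-`0` curve, rank-`1` twist), made exact; the twin of the tree's
`KrizLi2019.exists_mul_canonicalHeight_eq_index_sq_mul_regulator` (plus part). [folklore] -/
theorem exists_mul_canonicalHeight_eq_index_sq_mul_regulator_twist (h2 : Module.finrank F K = 2)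
    {θ : K} {c : F} (hθ : θ ∉ Set.range (algebraMap F K)) (hc : θ ^ 2 = algebraMap F K c)
    [(W.quadraticTwist c).IsElliptic]
    (hfinF : Finite W.toAffine.Point) (hrK : (W.baseChange K).mordellWeilRank = 1)
    (hrt : (W.quadraticTwist c).mordellWeilRank = 1)
    (P : (W.baseChange K).toAffine.Point) (hP : ¬ IsOfFinAddOrder P) :
    ∃ m : ℕ, (m = 1 ∨ m = 4) ∧
      (m : ℝ) * ((W.baseChange K).torsionOrder : ℝ) ^ 2 * P.canonicalHeight =
        2 * ((AddSubgroup.zmultiples P).index : ℝ) ^ 2 * (W.quadraticTwist c).regulator := by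
  haveI : (W.baseChange K).IsElliptic := isElliptic_baseChange' W K
  haveI : ((W.quadraticTwist c).baseChange K).IsElliptic := isElliptic_baseChange' (W.quadraticTwist c) K
  haveI : NeZero (2 : F) := ⟨two_ne_zero⟩
  -- generators over `K` (of `E`) and over `F` (of the twist)
  obtain ⟨gK, hgK, hgenK, huniqK, -⟩ :=
    exists_generator_regulator_eq_of_mordellWeilRank_eq_one (W.baseChange K) hrK
  obtain ⟨g, hg, hgen, -, hreg⟩ :=
    exists_generator_regulator_eq_of_mordellWeilRank_eq_one (W.quadraticTwist c) hrt
  set T := AddCommGroup.torsion (W.baseChange K).toAffine.Point with hT_def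
  -- the conjugation `σ` of `K/F` and its action on `E(K)`
  set σ := Quadratic.conj h2 hθ hc with hσ_def
  have hσσK : ∀ z, σ (σ z) = z := Quadratic.conj_conj h2 hθ hc
  set σW : (W.baseChange K).toAffine.Point →+ (W.baseChange K).toAffine.Point :=
    Affine.Point.map (W' := W) σ with hσW_def
  have hσσ : ∀ x, σW (σW x) = x := fun x ↦ QuadraticDescent.conjMap_conjMap W hσσK x
  -- uniqueness of coefficients modulo `T`
  have hcoef : ∀ {x : (W.baseChange K).toAffine.Point} {u v : ℤ},
      x - u • gK ∈ T → x - v • gK ∈ T → u = v := by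
    intro x u v hu hv
    have hmem : (u - v) • gK ∈ T := by
      have : (u - v) • gK = (x - v • gK) - (x - u • gK) := by rw [sub_smul]; abel
      rw [this]; exact T.sub_mem hv hu
    have := huniqK (u - v) hmem
    omega
  -- `σ gK ≡ e gK`; `gK + σ gK` is `F`-rational, hence torsion (`E(F)` finite), so `e = -1`
  obtain ⟨e, he⟩ := hgenK (σW gK)
  have hfix : σW (gK + σW gK) = gK + σW gK := by rw [map_add, hσσ, add_comm]
  obtain ⟨y, hy⟩ := AddMonoidHom.mem_range.mp
    (mem_range_incl_of_map_conj_eq W K h2 hθ hc (gK + σW gK) hfix)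
  have hyT : gK + σW gK ∈ T := by
    rw [← hy]
    haveI := hfinF
    exact (AddCommGroup.mem_torsion _).mpr
      ((QuadraticDescent.incl K W).isOfFinAddOrder (isOfFinAddOrder_of_finite y))
  have he1 : e = -1 := by
    -- `gK + σ gK ≡ (1 + e) gK` and `≡ 0 · gK`
    have h1 : gK + σW gK - (1 + e) • gK ∈ T := by
      have : gK + σW gK - (1 + e) • gK = σW gK - e • gK := by rw [add_smul, one_smul]; abel
      rw [this]; exact he
    have h0 : gK + σW gK - (0 : ℤ) • gK ∈ T := by rwa [zero_smul, sub_zero]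
    have := hcoef h1 h0
    omega
  -- the anti-fixed point `D = gK - σ gK ≡ 2 gK`
  set D := gK - σW gK with hD_def
  have hσD : σW D = -D := by rw [hD_def, map_sub, hσσ]; abel
  have hD2 : D - (2 : ℤ) • gK ∈ T := by
    have : D - (2 : ℤ) • gK = -(σW gK - e • gK) := by
      rw [hD_def, he1, two_zsmul, neg_one_zsmul]; abel
    rw [this]; exact T.neg_mem he
  ---------------------------------------------------------------- transport to the completed square `E' = W^{(1)}`
  obtain ⟨C, hC⟩ := W.exists_variableChange_quadraticTwist_one
  have hCK : (C • W).baseChange K = (W.quadraticTwist 1).baseChange K :=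
    congrArg (fun V : WeierstrassCurve F ↦ V.baseChange K) hC
  set Ψ : (W.baseChange K).toAffine.Point ≃+ ((W.quadraticTwist 1).baseChange K).toAffine.Point :=
    (VariableChange.pointEquivBaseChange W C K).trans (Affine.Point.congrEquiv hCK) with hΨ_def
  -- `Ψ` is Galois-equivariant and height-preserving
  have hΨσ : ∀ Q : (W.baseChange K).toAffine.Point,
      Ψ (σW Q) = Affine.Point.map (W' := W.quadraticTwist 1) σ (Ψ Q) := by
    intro Q
    simp only [hΨ_def, AddEquiv.trans_apply, hσW_def]
    rw [← VariableChange.pointEquivBaseChange_map W C σ Q]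
    exact congrEquiv_map hC σ _
  have hΨh : ∀ Q : (W.baseChange K).toAffine.Point, (Ψ Q).canonicalHeight = Q.canonicalHeight := by
    intro Q
    simp only [hΨ_def, AddEquiv.trans_apply]
    rw [canonicalHeight_congrEquiv, VariableChange.pointEquivBaseChange, AddEquiv.trans_apply,
      canonicalHeight_congrEquiv, Affine.Point.canonicalHeight_pointEquiv]
  -- `Ψ D` is anti-fixed on `E'(K)`, hence in the image of the twisting map `τ`
  set τ := QuadraticDescent.twistMap W hθ hc with hτ_def
  have hanti : Affine.Point.map (W' := W.quadraticTwist 1) σ (Ψ D) = -(Ψ D) := by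
    rw [← hΨσ, hσD, map_neg]
  obtain ⟨R, hR⟩ : ∃ R : (W.quadraticTwist c).toAffine.Point, τ R = Ψ D := by
    rcases hQ : Ψ D with _ | ⟨x, y, h⟩
    · exact ⟨0, by rw [map_zero, Affine.Point.zero_def]⟩
    · rw [hQ, Affine.Point.map_some, Affine.Point.neg_some, Affine.Point.some.injEq,
        QuadraticDescent.negY_quadraticTwist_one_baseChange] at hanti
      obtain ⟨a, ha⟩ := Quadratic.exists_eq_algebraMap_of_conj_eq h2 hθ hc hanti.1
      obtain ⟨b, hb⟩ := Quadratic.exists_eq_mul_of_conj_eq_neg h2 hθ hc hanti.2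
      exact QuadraticDescent.exists_twistMap_eq W hθ hc h ha.symm hb.symm
  -- pull `τ g` back to `E(K)`: `G' := Ψ⁻¹ (τ g) ≡ k gK`, of infinite order
  set G' := Ψ.symm (τ g) with hG'_def
  obtain ⟨k, hk⟩ := hgenK G'
  have hτg : ¬ IsOfFinAddOrder (τ g) := fun hfin ↦
    hg ((QuadraticDescent.twistMap_injective W hθ hc).isOfFinAddOrder_iff.mp hfin)
  have hG' : ¬ IsOfFinAddOrder G' := fun hfin ↦ by
    apply hτg
    have := Ψ.toAddMonoidHom.isOfFinAddOrder hfin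
    simpa [hG'_def] using this
  have hk0 : k ≠ 0 := by
    rintro rfl
    rw [zero_smul, sub_zero] at hk
    exact hG' ((AddCommGroup.mem_torsion _).mp hk)
  -- `R ≡ j g` in `E^{(c)}(F)`, so `D = Ψ⁻¹(τ R) ≡ j G' ≡ j k gK`; with `D ≡ 2 gK`: `j k = 2`
  obtain ⟨j, hj⟩ := hgen R
  have hDjk : D - (j * k) • gK ∈ T := by
    have hD' : D = Ψ.symm (τ R) := by rw [hR, AddEquiv.symm_apply_apply]
    -- `Ψ⁻¹ τ (R - j g)` is torsion
    have hA : D - j • G' ∈ T := by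
      have ht : IsOfFinAddOrder (R - j • g) := (AddCommGroup.mem_torsion _).mp hj
      have := (Ψ.symm.toAddMonoidHom.comp τ).isOfFinAddOrder ht
      rw [map_sub, map_zsmul] at this
      simpa [hD', hG'_def] using (AddCommGroup.mem_torsion _).mpr this
    have hB : j • G' - (j * k) • gK ∈ T := by
      have : j • G' - (j * k) • gK = j • (G' - k • gK) := by rw [mul_smul, smul_sub]
      rw [this]; exact T.zsmul_mem hk j
    have : D - (j * k) • gK = (D - j • G') + (j • G' - (j * k) • gK) := by abel
    rw [this]; exact T.add_mem hA hB
  have hjk : j * k = 2 := hcoef hDjk hD2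
  have hk2 : k ^ 2 = 1 ∨ k ^ 2 = 4 := by
    have hkdvd : k ∣ 2 := ⟨j, by rw [mul_comm]; exact hjk.symm⟩
    have hkabs : k.natAbs ∣ 2 := by exact_mod_cast Int.natAbs_dvd_natAbs.mpr hkdvd
    have hle : k.natAbs ≤ 2 := Nat.le_of_dvd two_pos hkabs
    have hpos : 0 < k.natAbs := Int.natAbs_pos.mpr hk0
    have hsq : k ^ 2 = (k.natAbs : ℤ) ^ 2 := (Int.natAbs_sq k).symm
    interval_cases h : k.natAbs
    · left; rw [hsq]; norm_num
    · right; rw [hsq]; norm_num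
  ---------------------------------------------------------------- heights
  -- `ĥ_K(G') = ĥ_K(τ g) = ĥ_K(ι g) = 2 ĥ_F(g) = 2 Reg(E^{(c)}/F)`
  have hhG' : G'.canonicalHeight = 2 * g.canonicalHeight := by
    have h1 : G'.canonicalHeight = (τ g).canonicalHeight := by
      rw [← hΨh G', hG'_def, AddEquiv.apply_symm_apply]
    have h2' : (τ g).canonicalHeight = (QuadraticDescent.incl K (W.quadraticTwist c) g).canonicalHeight := by
      simp only [hτ_def, QuadraticDescent.twistMap, AddMonoidHom.coe_comp, AddEquiv.toAddMonoidHom_eq_coe,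
        AddMonoidHom.coe_coe, Function.comp_apply]
      rw [canonicalHeight_congrEquiv, Affine.Point.canonicalHeight_pointEquiv]
    have h3 : (QuadraticDescent.incl K (W.quadraticTwist c) g).canonicalHeight = 2 * g.canonicalHeight := by
      have h := Affine.Point.canonicalHeight_baseChange (R := F) (K := F) (L := K)
        (W := W.quadraticTwist c) g
      rw [h2] at h
      exact_mod_cast h
    rw [h1, h2', h3]
  -- `ĥ_K(P) = a² ĥ_K(gK)`, `ĥ_K(G') = k² ĥ_K(gK)`, `[E(K):ℤP] = |a|·#E(K)_tors`
  obtain ⟨a, ha⟩ := hgenK P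
  have ha0 : a ≠ 0 := by
    rintro rfl
    rw [zero_smul, sub_zero] at ha
    exact hP ((AddCommGroup.mem_torsion _).mp ha)
  have hhPa : P.canonicalHeight = (a : ℝ) ^ 2 * gK.canonicalHeight :=
    canonicalHeight_eq_of_sub_zsmul_mem_torsion (W.baseChange K) ha
  have hhGk : G'.canonicalHeight = (k : ℝ) ^ 2 * gK.canonicalHeight :=
    canonicalHeight_eq_of_sub_zsmul_mem_torsion (W.baseChange K) hk
  have hidx : (AddSubgroup.zmultiples P).index = a.natAbs * (W.baseChange K).torsionOrder :=
    index_zmultiples_eq (W.baseChange K) hgK hgenK ha0 ha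
  refine ⟨(k ^ 2).toNat, ?_, ?_⟩
  · rcases hk2 with h | h <;> simp [h]
  · have hcast : (((k ^ 2).toNat : ℕ) : ℝ) = (k : ℝ) ^ 2 := by
      have : ((k ^ 2).toNat : ℤ) = k ^ 2 := Int.toNat_of_nonneg (sq_nonneg k)
      exact_mod_cast this
    rw [hcast, hidx, hreg, hhPa]
    have hasq : ((a.natAbs : ℕ) : ℝ) ^ 2 = (a : ℝ) ^ 2 := by
      rw [Nat.cast_natAbs, Int.cast_abs, sq_abs]
    push_cast
    rw [mul_pow]
    have key : (k : ℝ) ^ 2 * gK.canonicalHeight = 2 * g.canonicalHeight := by rw [← hhGk, hhG']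
    calc (k : ℝ) ^ 2 * ((W.baseChange K).torsionOrder : ℝ) ^ 2 * ((a : ℝ) ^ 2 * gK.canonicalHeight)
        = ((W.baseChange K).torsionOrder : ℝ) ^ 2 * (a : ℝ) ^ 2 *
            ((k : ℝ) ^ 2 * gK.canonicalHeight) := by ring
      _ = 2 * ((a.natAbs : ℝ) ^ 2 * ((W.baseChange K).torsionOrder : ℝ) ^ 2) *
            g.canonicalHeight := by rw [key, hasq]; ring

end Minus

end Summit.BirchSwinnertonDyer.Rank1Residual.X1.RankZeroHeightIndex

end
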